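import Mathlib
import Literature.RingTheory.Multisymmetric.Weyl

/-!
# Graded Newton: polarized power sums are combinations of elementary multisymmetric monomials
# of the same content

Continuation of `Literature/RingTheory/Multisymmetric/Weyl.lean` (notation: `n` vectors with
coordinates `ι`, variables `X (i, j)`, polarized power sums `p_β = powerSum ι n β`, elementary
multisymmetric polynomials `e_α = elemMultisymm ι n α`).

The polynomial ring `k[V^n] = MvPolynomial (ι × Fin n) k` is graded by CONTENT: the weight of the
variable `X (i, j)` is the basis vector `i` of `ι →₀ ℕ` (`contentWt`), so that a monomial has weight
"how often each coordinate letter occurs".  `e_α` is weighted homogeneous of content `α`, `p_β` of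
content `β` (`elemMultisymm_isWeightedHomogeneous`, `powerSum_isWeightedHomogeneous`), and the
*elementary monomial* `elemProd ι n s = ∏_α e_α ^ (s α)` of a vector partition `s` (a multiplicity
function on multi-exponents) has content `vpContent s = ∑_α (s α) • α`.

**Theorem** (`powerSum_mem_elemSpan`, characteristic zero).  `p_β` is a `k`-linear combination of the
elementary monomials `elemProd s` of content EXACTLY `β` with nonzero parts — the graded refinement of
Weyl's `powerSum_mem_adjoin_elemMultisymm` (`p_β ∈ k[e_α : α]`), obtained by projecting a polynomial
expression onto its content-`β` component.  Consequently (`powerSumProd_mem_elemSpan`) every power-sum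
monomial `∏ p_β^{s β}` lies in the span of the elementary monomials of the same content.  This is the
form of Newton's identities for several vectors used in
`Literature/RingTheory/Multisymmetric/LowDegreeFreeness.lean`.

References: H. Weyl, *The Classical Groups*, Chap. II §3; P. A. MacMahon, *Combinatory Analysis* II
§XI (the multipartite Newton relations); M. Domokos, arXiv:0706.2154 §2.
-/

noncomputable section

open MvPolynomial

namespace Literature.RingTheory.Multisymmetric

variable {k : Type*} [Field k] (ι : Type*) [Fintype ι] [DecidableEq ι] (n : ℕ)

/-! ### Content grading -/

/-- The CONTENT weight: the variable `X (i, j)` (coordinate `i` of vector `j`) has weight the basis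
vector `i` of `ι →₀ ℕ`. [folklore] -/
def contentWt : ι × Fin n → (ι →₀ ℕ) := fun p => Finsupp.single p.1 1

/-- The elementary monomial `∏_α e_α ^ (s α)` of a vector partition `s`.
[cite: Weyl1939, Chap. II §3 (Theorem 2.3.A)] -/
def elemProd (s : (ι →₀ ℕ) →₀ ℕ) : MvPolynomial (ι × Fin n) k :=
  s.prod fun α e => elemMultisymm ι n α ^ e

variable {ι n}

/-- The content `∑_α (s α) • α` of a vector partition. [folklore] -/
def vpContent (s : (ι →₀ ℕ) →₀ ℕ) : ι →₀ ℕ :=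
  s.sum fun α e => e • α

variable (ι n)

/-- The span of the elementary monomials of content `β` with nonzero parts. [folklore] -/
def elemSpan (β : ι →₀ ℕ) : Submodule k (MvPolynomial (ι × Fin n) k) :=
  Submodule.span k {x | ∃ s : (ι →₀ ℕ) →₀ ℕ, (∀ α ∈ s.support, α ≠ 0) ∧ vpContent s = β ∧
    elemProd (k := k) ι n s = x}

variable {ι n}

omit [Fintype ι] [DecidableEq ι] in
/-- Content is additive. [folklore] -/
theorem vpContent_add (s t : (ι →₀ ℕ) →₀ ℕ) : vpContent (s + t) = vpContent s + vpContent t := by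
  unfold vpContent
  exact Finsupp.sum_add_index' (fun _ => zero_smul _ _) (fun _ _ _ => add_smul _ _ _)

omit [Fintype ι] [DecidableEq ι] in
/-- The empty vector partition has content `0`. [folklore] -/
@[simp] theorem vpContent_zero : vpContent (0 : (ι →₀ ℕ) →₀ ℕ) = 0 := by
  simp [vpContent]

omit [Fintype ι] [DecidableEq ι] in
/-- The content of `e` copies of the part `α` is `e • α`. [folklore] -/
theorem vpContent_single (α : ι →₀ ℕ) (e : ℕ) : vpContent (Finsupp.single α e) = e • α := by
  unfold vpContent
  exact Finsupp.sum_single_index (zero_smul _ _)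

omit [Fintype ι] [DecidableEq ι] in
/-- Erasing the zero part does not change the content. [folklore] -/
theorem vpContent_erase_zero (s : (ι →₀ ℕ) →₀ ℕ) : vpContent (s.erase 0) = vpContent s := by
  classical
  conv_rhs => rw [← Finsupp.erase_add_single 0 s, vpContent_add, vpContent_single, smul_zero,
    add_zero]

omit [DecidableEq ι] in
/-- Elementary monomials multiply by adding vector partitions. [folklore] -/
theorem elemProd_add (s t : (ι →₀ ℕ) →₀ ℕ) :
    elemProd (k := k) ι n (s + t) = elemProd ι n s * elemProd ι n t := by
  unfold elemProd
  exact Finsupp.prod_add_index' (fun _ => pow_zero _) (fun _ _ _ => pow_add _ _ _)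

omit [DecidableEq ι] in
/-- The elementary monomial of the empty vector partition is `1`. [folklore] -/
@[simp] theorem elemProd_zero : elemProd (k := k) ι n 0 = 1 := by
  simp [elemProd]

omit [DecidableEq ι] in
/-- The elementary monomial of `e` copies of `α` is `e_α ^ e`. [folklore] -/
theorem elemProd_single (α : ι →₀ ℕ) (e : ℕ) :
    elemProd (k := k) ι n (Finsupp.single α e) = elemMultisymm ι n α ^ e := by
  unfold elemProd
  exact Finsupp.prod_single_index (pow_zero _)

omit [DecidableEq ι] in
/-- `e_0 = 1` (the constant term of the generating product). [folklore] -/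
theorem elemMultisymm_zero : elemMultisymm (k := k) ι n 0 = 1 := by
  rw [elemMultisymm, genElem, ← constantCoeff_eq, map_prod]
  refine Finset.prod_eq_one fun j _ => ?_
  rw [map_add, map_one, zLin, map_sum, Finset.sum_eq_zero (fun i _ => ?_), add_zero]
  rw [map_mul, constantCoeff_X, mul_zero]

omit [DecidableEq ι] in
/-- Erasing the zero part does not change the elementary monomial (`e_0 = 1`). [folklore] -/
theorem elemProd_erase_zero (s : (ι →₀ ℕ) →₀ ℕ) :
    elemProd (k := k) ι n (s.erase 0) = elemProd ι n s := by
  classical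
  conv_rhs => rw [← Finsupp.erase_add_single 0 s, elemProd_add, elemProd_single,
    elemMultisymm_zero, one_pow, mul_one]

/-! ### Homogeneity for the content grading -/

omit [Fintype ι] [DecidableEq ι] in
/-- The content of a monomial exponent placed in column `j` is the exponent itself. [folklore] -/
theorem weight_contentWt_mapDomain (β : ι →₀ ℕ) (j : Fin n) :
    Finsupp.weight (contentWt ι n) (β.mapDomain fun i => (i, j)) = β := by
  rw [Finsupp.weight_apply, Finsupp.sum_mapDomain_index (h := fun p c => c • contentWt ι n p)
    (fun _ => zero_smul ℕ _) (fun _ _ _ => add_smul _ _ _)]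
  simp only [contentWt]
  conv_rhs => rw [← Finsupp.sum_single β]
  exact Finsupp.sum_congr fun i _ => by rw [Finsupp.smul_single_one]

omit [Fintype ι] [DecidableEq ι] in
/-- `p_β` is weighted homogeneous of content `β`. [folklore] -/
theorem powerSum_isWeightedHomogeneous (β : ι →₀ ℕ) :
    IsWeightedHomogeneous (contentWt ι n) (powerSum (k := k) ι n β) β := by
  unfold powerSum colMonomial
  exact IsWeightedHomogeneous.sum _ _ _ fun j _ =>
    isWeightedHomogeneous_monomial _ _ _ (weight_contentWt_mapDomain β j)

/-- Bihomogeneity of a polynomial in the auxiliary variables `T`: its `T^α`-coefficient has content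
`α`. [folklore] -/
private def BiHom (P : MvPolynomial ι (MvPolynomial (ι × Fin n) k)) : Prop :=
  ∀ α : ι →₀ ℕ, IsWeightedHomogeneous (contentWt ι n) (coeff α P) α

omit [Fintype ι] in
/-- `1` is bihomogeneous. [folklore] -/
private theorem biHom_one : BiHom (k := k) (n := n) (ι := ι) 1 := by
  intro α
  rw [coeff_one]
  split_ifs with h
  · subst h; exact isWeightedHomogeneous_one _ _
  · exact isWeightedHomogeneous_zero _ _ _

omit [Fintype ι] [DecidableEq ι] in
/-- Bihomogeneity is stable under sums. [folklore] -/
private theorem BiHom.add {P Q : MvPolynomial ι (MvPolynomial (ι × Fin n) k)} (hP : BiHom P)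
    (hQ : BiHom Q) : BiHom (P + Q) := fun α => by
  rw [coeff_add]; exact (hP α).add (hQ α)

omit [Fintype ι] in
/-- Bihomogeneity is stable under products. [folklore] -/
private theorem BiHom.mul {P Q : MvPolynomial ι (MvPolynomial (ι × Fin n) k)} (hP : BiHom P)
    (hQ : BiHom Q) : BiHom (P * Q) := fun α => by
  rw [coeff_mul]
  refine IsWeightedHomogeneous.sum _ _ _ fun x hx => ?_
  have h := (hP x.1).mul (hQ x.2)
  have hx' : x.1 + x.2 = α := Finset.HasAntidiagonal.mem_antidiagonal.mp hx
  rwa [hx'] at h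

omit [Fintype ι] in
/-- Bihomogeneity is stable under finite products. [folklore] -/
private theorem BiHom.prod {κ : Type*} (S : Finset κ)
    (P : κ → MvPolynomial ι (MvPolynomial (ι × Fin n) k)) (h : ∀ x ∈ S, BiHom (P x)) :
    BiHom (∏ x ∈ S, P x) := by
  classical
  induction S using Finset.induction_on with
  | empty => rw [Finset.prod_empty]; exact biHom_one
  | insert x S hx ih =>
    rw [Finset.prod_insert hx]
    exact (h x (Finset.mem_insert_self _ _)).mul (ih fun y hy => h y (Finset.mem_insert_of_mem hy))

/-- The generic linear form `z_j` is bihomogeneous. [folklore] -/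
private theorem biHom_zLin (j : Fin n) : BiHom (zLin (k := k) ι n j) := by
  unfold zLin
  have hterm : ∀ i : ι, BiHom (C (X (i, j) : MvPolynomial (ι × Fin n) k) * X i) := by
    intro i α
    classical
    rw [coeff_C_mul, coeff_X]
    split_ifs with h
    · rw [mul_one, ← h]
      exact isWeightedHomogeneous_X k (contentWt ι n) (i, j)
    · rw [mul_zero]; exact isWeightedHomogeneous_zero _ _ _
  have : ∀ S : Finset ι, BiHom (∑ i ∈ S, C (X (i, j) : MvPolynomial (ι × Fin n) k) * X i) := by
    intro S
    induction S using Finset.induction_on with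
    | empty =>
      rw [Finset.sum_empty]; exact fun α => by rw [coeff_zero]; exact isWeightedHomogeneous_zero _ _ _
    | insert x S hx ih => rw [Finset.sum_insert hx]; exact (hterm x).add ih
  exact this _

/-- **`e_α` is weighted homogeneous of content `α`.** [folklore] -/
theorem elemMultisymm_isWeightedHomogeneous (α : ι →₀ ℕ) :
    IsWeightedHomogeneous (contentWt ι n) (elemMultisymm (k := k) ι n α) α := by
  have h : BiHom (genElem (k := k) ι n) := by
    unfold genElem
    exact BiHom.prod _ _ fun j _ => biHom_one.add (biHom_zLin j)
  exact h α

/-- The elementary monomial of `s` is weighted homogeneous of content `vpContent s`. [folklore] -/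
theorem elemProd_isWeightedHomogeneous (s : (ι →₀ ℕ) →₀ ℕ) :
    IsWeightedHomogeneous (contentWt ι n) (elemProd (k := k) ι n s) (vpContent s) := by
  unfold elemProd vpContent Finsupp.prod Finsupp.sum
  exact IsWeightedHomogeneous.prod _ _ _ fun α _ => (elemMultisymm_isWeightedHomogeneous α).pow _

/-! ### Graded Newton -/

omit [DecidableEq ι] in
/-- The span of ALL elementary monomials is closed under multiplication and contains `k[e_α]`.
[folklore] -/
theorem elemSubalgebra_le_span_elemProd :
    Subalgebra.toSubmodule (elemSubalgebra (k := k) ι n) ≤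
      Submodule.span k (Set.range (elemProd (k := k) ι n)) := by
  set A : Submodule k (MvPolynomial (ι × Fin n) k) := Submodule.span k (Set.range (elemProd ι n))
    with hA
  have h1 : (1 : MvPolynomial (ι × Fin n) k) ∈ A :=
    Submodule.subset_span ⟨0, elemProd_zero⟩
  have hmul : ∀ x y, x ∈ A → y ∈ A → x * y ∈ A := by
    intro x y hx hy
    have hxy : x * y ∈ A * A := Submodule.mul_mem_mul hx hy
    rw [hA, Submodule.span_mul_span] at hxy
    refine Submodule.span_mono ?_ hxy
    rintro _ ⟨a, ⟨s, rfl⟩, b, ⟨t, rfl⟩, rfl⟩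
    exact ⟨s + t, elemProd_add s t⟩
  let B : Subalgebra k (MvPolynomial (ι × Fin n) k) := A.toSubalgebra h1 hmul
  have hle : elemSubalgebra (k := k) ι n ≤ B := by
    refine Algebra.adjoin_le ?_
    rintro _ ⟨α, rfl⟩
    change elemMultisymm ι n α ∈ A
    refine Submodule.subset_span ⟨Finsupp.single α 1, ?_⟩
    rw [elemProd_single, pow_one]
  intro x hx
  exact hle hx

/-- The content-`β` component of an elementary monomial lies in `elemSpan β`. [folklore] -/
theorem weightedHomogeneousComponent_elemProd_mem (β : ι →₀ ℕ) (s : (ι →₀ ℕ) →₀ ℕ) :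
    weightedHomogeneousComponent (contentWt ι n) β (elemProd (k := k) ι n s) ∈ elemSpan ι n β := by
  classical
  rw [weightedHomogeneousComponent_of_mem (elemProd_isWeightedHomogeneous s)]
  split_ifs with h
  · refine Submodule.subset_span ⟨s.erase 0, ?_, ?_, elemProd_erase_zero s⟩
    · intro α hα
      rw [Finsupp.support_erase] at hα
      exact Finset.ne_of_mem_erase hα
    · rw [vpContent_erase_zero, h]
  · exact Submodule.zero_mem _

/-- **Graded Newton identities.**  In characteristic zero the polarized power sum `p_β` is a
`k`-linear combination of the elementary monomials `∏ e_α^{s α}` of content exactly `β` (with nonzero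
parts `α`). [cite: Weyl1939, Chap. II §3 (Theorem 2.3.A)] -/
theorem powerSum_mem_elemSpan [CharZero k] (β : ι →₀ ℕ) :
    powerSum (k := k) ι n β ∈ elemSpan ι n β := by
  classical
  have hp : powerSum (k := k) ι n β ∈ Submodule.span k (Set.range (elemProd (k := k) ι n)) :=
    elemSubalgebra_le_span_elemProd (powerSum_mem_adjoin_elemMultisymm ι n β)
  rw [← (powerSum_isWeightedHomogeneous (k := k) β).weightedHomogeneousComponent_same]
  refine Submodule.span_induction (p := fun x _ =>
    weightedHomogeneousComponent (contentWt ι n) β x ∈ elemSpan (k := k) ι n β) ?_ ?_ ?_ ?_ hp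
  · rintro _ ⟨s, rfl⟩
    exact weightedHomogeneousComponent_elemProd_mem β s
  · rw [map_zero]; exact Submodule.zero_mem _
  · intro x y _ _ hx hy
    rw [map_add]; exact Submodule.add_mem _ hx hy
  · intro c x _ hx
    rw [map_smul]; exact Submodule.smul_mem _ c hx

/-! ### Products -/

/-- `elemSpan` is multiplicative in the content. [folklore] -/
theorem mul_mem_elemSpan {β γ : ι →₀ ℕ} {x y : MvPolynomial (ι × Fin n) k}
    (hx : x ∈ elemSpan ι n β) (hy : y ∈ elemSpan ι n γ) : x * y ∈ elemSpan ι n (β + γ) := by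
  have hxy : x * y ∈ elemSpan (k := k) ι n β * elemSpan ι n γ := Submodule.mul_mem_mul hx hy
  rw [elemSpan, elemSpan, Submodule.span_mul_span] at hxy
  refine Submodule.span_mono ?_ hxy
  rintro _ ⟨a, ⟨s, hs, hsβ, rfl⟩, b, ⟨t, ht, htγ, rfl⟩, rfl⟩
  refine ⟨s + t, ?_, ?_, elemProd_add s t⟩
  · intro α hα
    rcases Finset.mem_union.mp (Finsupp.support_add hα) with h | h
    · exact hs α h
    · exact ht α h
  · rw [vpContent_add, hsβ, htγ]

omit [DecidableEq ι] in
/-- `1 ∈ elemSpan 0`. [folklore] -/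
theorem one_mem_elemSpan_zero : (1 : MvPolynomial (ι × Fin n) k) ∈ elemSpan ι n 0 :=
  Submodule.subset_span ⟨0, by simp, vpContent_zero, elemProd_zero⟩

/-- Powers: `elemSpan β ^ e ≤ elemSpan (e • β)`. [folklore] -/
theorem pow_mem_elemSpan {β : ι →₀ ℕ} {x : MvPolynomial (ι × Fin n) k} (hx : x ∈ elemSpan ι n β)
    (e : ℕ) : x ^ e ∈ elemSpan ι n (e • β) := by
  induction e with
  | zero => rw [pow_zero, zero_smul]; exact one_mem_elemSpan_zero
  | succ e ih => rw [pow_succ, succ_nsmul]; exact mul_mem_elemSpan ih hx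

/-- **Power-sum monomials lie in the span of the elementary monomials of the same content.**
[cite: Weyl1939, Chap. II §3 (Theorem 2.3.A)] -/
theorem powerSumProd_mem_elemSpan [CharZero k] (s : (ι →₀ ℕ) →₀ ℕ) :
    (s.prod fun β e => powerSum (k := k) ι n β ^ e) ∈ elemSpan ι n (vpContent s) := by
  classical
  unfold Finsupp.prod vpContent Finsupp.sum
  induction s.support using Finset.induction_on with
  | empty => rw [Finset.prod_empty, Finset.sum_empty]; exact one_mem_elemSpan_zero
  | insert β S hβ ih =>
    rw [Finset.prod_insert hβ, Finset.sum_insert hβ]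
    exact mul_mem_elemSpan (pow_mem_elemSpan (powerSum_mem_elemSpan β) _) ih

end Literature.RingTheory.Multisymmetric
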